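import Literature.Topology.FourManifolds.LinkGaussDiagramsRealisation
import Literature.Topology.FourManifolds.KirbyMoves
import HarnessLib

/-!
# Framed link diagrams: sliced (Morse-position) diagrams of framed links and their realisation

Definition request `defn-FramedLinkDiagram.Realises` (route `VerlindeRLinks` of `SmoothPoincare4`,
cruxes `VrlSlideGap` / `VrlSliceRigidity`): a COMBINATORIAL CARRIER for ordered, oriented,
integrally framed links with finitely many components, realised into
`Literature.Topology.FourManifolds.FramedLink ι` (`KirbyMoves.lean`). This is the first file
(carrier, reading, realisation); the move calculus (Reidemeister–Turaev moves and the
diagrammatic handle slide) is `FramedLinkDiagramMoves.lean`.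

## The carrier

A **framed link diagram** `D : FramedLinkDiagram ι` is

* a *sliced link diagram* `D.word : List (FramedLinkDiagram.Slice ι)` — a planar link diagram
  in Morse position with respect to the height of the page, cut by horizontal lines into
  elementary slices, read from BOTTOM to TOP, each slice containing exactly one event on a row of
  strands numbered `0, 1, …` from the left (Turaev's "products of simple tangles",
  Chmutov–Duzhin–Mostovoy (2012), §1.6.5; Kauffman (1991), Part I §9, "cups, caps and
  interactions"; the same format as the plat words `Literature.QuantumTopology.MixedVerlinde.PlatWord`
  of `HandlebodyInvariant.lean`):
  - `cup i c ltr` — a local minimum of the component labelled `c : ι` creating two strands at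
    positions `i, i + 1`; `ltr = true` iff it is traversed from left to right (the left branch is
    oriented downwards, the right branch upwards) — the ORIENTATION of the link lives here;
  - `cap i` — a local maximum joining the strands at positions `i, i + 1` (which must carry the
    same label and opposite vertical orientations);
  - `cross i over` — the strands at positions `i, i + 1` cross; `over = true` iff the strand going
    from bottom-left to top-right passes OVER (larger `height`, nearer to the viewer);
* an INTEGER framing `D.framing : ι → ℤ` of each component (the integer written next to a
  component of a Kirby diagram: the linking number of the push-off with the component,
  Gompf–Stipsicz (1999), §4.4; exactly the datum `FramedLink.framing`). Framings are NOT
  blackboard framings: the word may be changed by all three Reidemeister moves without touching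
  `framing` (the discrepancy with the blackboard framing of component `c` is
  `D.framing c - D.writhe c`, see `twistDefect`).

Everything is finite data: `DecidableEq`, `Repr`, and all readings below are computable, so
concrete diagrams (the `n`-component unlink `unlinkDiagram`, the Hopf link `hopfDiagram`, the
trefoil `trefoilDiagram`; the links `L_{n,k}` of Gompf–Scharlemann–Thompson can be typed in the
same way) are closed terms whose well-formedness, Gauss readings, writhes and linking numbers
evaluate by `decide` (§5).

## The reading and the realisation

The word is read by tracing (§2): the rows of labelled oriented strands below each slice
(`rowBelow`), closedness (`IsClosed`: the word starts and ends with no strand and every slice is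
applicable), the crossings `k : Fin D.numCross` in the order of the word with their two PASSAGES
`(k, true)` (the strand entering from bottom-left) and `(k, false)` (from bottom-right), the
over-passage `(k, D.crossOver k)`, the sign `D.crossSign k ∈ ℤˣ` (right-handed crossings are
`+1`, computed from the two vertical orientations and `over`, with the conventions of
`Knot.RegularProjection.sign_eq`: `sign = sign det (γ'ₒᵥₑᵣ, γ'ᵤₙₔₑᵣ)` in the oriented page),
the component label of a passage, and the TRAVERSAL SUCCESSOR `D.succ? x` of a passage (follow
the oriented strand through cups and caps to the next crossing). This is exactly the datum of a
component-labelled link Gauss diagram (`LinkGaussDiagram` + `comp`, GPV (2000), §1), and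
`D.Realises L` (§3) says: `L.framing = D.framing`, the word is well formed (`IsWellFormed`:
closed, every label of `ι` drawn, each label ONE closed curve), and some regular projection
`P : L.toLink.RegularProjection` (`LinkGaussDiagramsRealisation.lean`: stereographic projection
from the north pole, honest geometric clauses) reads this Gauss datum — there are bijections
`κ` (crossings ↔ chords) and `e` (passages ↔ marked points) carrying over/under-passages, signs,
successors and component labels to `P.diagram.overPos/underPos/sign/next` and `P.comp`, and the
chord-free circles of `P` are the crossing-free labels of `D`. As `Knot.HasGaussDiagram` and
`Link.HasGaussDiagram`, `Realises` is an honest predicate on the embedding `L`, not invariant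
under isotopy; statements about link types quantify over isotopic representatives (§4).

## Named facts (D-0014; `def … : Prop`, cited, not proved here)

* `FramedLink.exists_realises_of_isIsotopic` (R1, generic projections in Morse position exist);
* `FramedLinkDiagram.exists_realises_of_isWellFormed` (every well-formed diagram is the diagram
  of some framed link — so a link may be NAMED by a diagram);
the Reidemeister–Turaev theorem (R2) and the handle-slide correspondence (R3) are in
`FramedLinkDiagramMoves.lean`.

## Design notes

* Why sliced words rather than labelled Gauss diagrams as the PRIMARY carrier: every word is a
  planar picture (no virtual diagrams, no planarity predicate), the Reidemeister–Turaev moves and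
  the band of a handle slide are LOCAL rewrites of the list (next file), and the slices have the
  shape of those of the plat words on which `mixedVerlindeHandlebodyInvariant` is computed
  (`cup`/`cap`/`cross`, labels ↦ `Strand.handle`), so that translation is immediate. The Gauss
  reading (this file) connects the carrier to the realisation tower `Link.RegularProjection`,
  which is phrased in Gauss-diagram terms.
* `Realises` matches the reading RELATIONALLY (bijections `κ`, `e`) instead of manufacturing a
  `LinkGaussDiagram` from the word: no proof obligations are hidden in the carrier, ill-formed
  words simply realise nothing, and concrete instances are checked by `decide`.
* Not here, deliberately: the plat word of the DUAL dotted-circle diagram fed to the route's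
  `mixedVerlindeRLinkInvariant` — it depends on a trivialisation of the surgered boundary
  `#ⁿ(S¹ × S²)` (a Kirby-move certificate), not on the link diagram alone (module docstring of
  `HandlebodyInvariant.lean`, "The route's σ_p"); and blackboard adjustment of framings (add
  `twistDefect c` curls to component `c`), which belongs with that translation.

## References

* S. Chmutov, S. Duzhin, J. Mostovoy, *Introduction to Vassiliev knot invariants* (2012), §1.6.5
  (elementary and simple tangles, sliced presentation of links), Thm. 1.23 (Turaev moves),
  §1.7.1 (integer framings), §1.8.4 (Gauss diagrams of links). [ChmutovDuzhinMostovoy2012]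
* L. H. Kauffman, *Knots and Physics* (1991), Part I §9 (diagrams arranged with respect to a
  height function: cups, caps, interactions; the moves a)–d)). [Kauffman1991]
* M. Goussarov, M. Polyak, O. Viro, Topology 39 (2000), §1 (Gauss diagrams of links). [GPV2000]
* A. Juhász, *Differential and low-dimensional topology* (2023), Thm. 4.4 and its proof
  (Reidemeister's theorem; links with the same diagram are isotopic), Def. 4.5 (sign of a
  crossing), §6.1 (ii) (handle slides). [Juhasz2023]
* R. E. Gompf, A. I. Stipsicz, *4-manifolds and Kirby calculus* (1999), §4.4 (framings as
  integers), §5.1. [GompfStipsicz1999]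
* K. Reidemeister, *Knotentheorie* (1932), Kap. I §1 (regular projections). [Reidemeister1932]
-/

open Function Set

namespace Literature.Topology.FourManifolds

universe u

namespace FramedLinkDiagram

/-! ## 1. Slices, rows, closed words -/

/-- **Elementary slices** of a sliced link diagram, read from bottom to top on a row of strands
numbered from the left (Chmutov–Duzhin–Mostovoy (2012), §1.6.5; Kauffman (1991), I §9):
`cup i c ltr` — local minimum of component `c` creating the strands `i, i + 1`, traversed left to
right iff `ltr`; `cap i` — local maximum joining the strands `i, i + 1`; `cross i over` — the
strands `i, i + 1` cross, the bottom-left-to-top-right strand being over iff `over`.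
[cite: ChmutovDuzhinMostovoy2012, §1.6.5] -/
inductive Slice (ι : Type u)
  /-- A local minimum at positions `i, i + 1` of the component `c`; `ltr`: traversed left to
  right (left branch oriented downwards, right branch upwards). -/
  | cup (i : ℕ) (c : ι) (ltr : Bool)
  /-- A local maximum joining the strands at positions `i, i + 1`. -/
  | cap (i : ℕ)
  /-- A crossing of the strands at positions `i, i + 1`; `over`: the strand going from
  bottom-left to top-right passes over. -/
  | cross (i : ℕ) (over : Bool)
  deriving DecidableEq, Repr

variable {ι : Type u}

/-- A **port**: a strand crossing a horizontal line, recorded by its component label and its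
vertical orientation (`true` = upwards). [folklore] -/
abbrev Port (ι : Type u) : Type u := ι × Bool

namespace Slice

/-- The position (leftmost strand number) of the event of a slice. [folklore] -/
def pos : Slice ι → ℕ
  | cup i _ _ => i
  | cap i => i
  | cross i _ => i

/-- Whether a slice is a crossing. [folklore] -/
def isCross : Slice ι → Bool
  | cross _ _ => true
  | _ => false

/-- The `over` bit of a crossing slice (junk `false` on cups and caps). [folklore] -/
def overBit : Slice ι → Bool
  | cross _ o => o
  | _ => false

/-- **One slice acting on the row of ports below it**, giving the row above it, or `none` if the
slice is not applicable: a cup inserts the two new ports `(c, !ltr), (c, ltr)` at positions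
`i, i + 1` (needs `i ≤ width`); a cap needs equal labels and opposite orientations at `i, i + 1`
and deletes them; a crossing swaps the ports at `i, i + 1`. [folklore] -/
def step [DecidableEq ι] : Slice ι → List (Port ι) → Option (List (Port ι))
  | cup i c ltr, r => if i ≤ r.length then some (r.take i ++ (c, !ltr) :: (c, ltr) :: r.drop i)
      else none
  | cap i, r =>
      match r[i]?, r[i + 1]? with
      | some (c, u), some (c', u') =>
          if c = c' ∧ u ≠ u' then some (r.take i ++ r.drop (i + 2)) else none
      | _, _ => none
  | cross i _, r =>
      match r[i]?, r[i + 1]? with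
      | some a, some b => some (r.take i ++ b :: a :: r.drop (i + 2))
      | _, _ => none

end Slice

end FramedLinkDiagram

/-- A **framed link diagram** with components labelled by `ι`: a sliced oriented link diagram
`word` (slices from bottom to top, Chmutov–Duzhin–Mostovoy (2012), §1.6.5) and an INTEGER
framing of each component (Gompf–Stipsicz (1999), §4.4: the linking number of the push-off with
the component, as in `FramedLink.framing`; not the blackboard framing).
[cite: ChmutovDuzhinMostovoy2012, §1.6.5] -/
structure FramedLinkDiagram (ι : Type u) where
  /-- The sliced diagram, read from bottom to top. -/
  word : List (FramedLinkDiagram.Slice ι)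
  /-- The integer framing of each component. -/
  framing : ι → ℤ

namespace FramedLinkDiagram

variable {ι : Type u}

/-- Framed link diagrams with finitely many decidable labels have decidable equality (words are
finite data, framings are compared componentwise). [folklore] -/
instance [DecidableEq ι] [Fintype ι] : DecidableEq (FramedLinkDiagram ι) := fun D D' =>
  decidable_of_iff (D.word = D'.word ∧ D.framing = D'.framing)
    ⟨fun h => by
      obtain ⟨w, f⟩ := D
      obtain ⟨w', f'⟩ := D'
      obtain ⟨h₁, h₂⟩ := h
      simp only at h₁ h₂
      subst h₁ h₂
      rfl,
     fun h => h ▸ ⟨rfl, rfl⟩⟩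

section Reading

variable [DecidableEq ι] (D : FramedLinkDiagram ι)

/-- The row of ports on the horizontal line below slice number `m` (between slices `m - 1` and
`m`; `m = 0` is the bottom of the picture, the empty row), or `none` if some earlier slice is not
applicable. [folklore] -/
def rowBelow (m : ℕ) : Option (List (Port ι)) :=
  (D.word.take m).foldlM (fun r s => s.step r) []

/-- The word is **closed**: every slice is applicable to the row below it and the picture starts
and ends with no strand (a diagram of a closed link, i.e. a `(0, 0)`-tangle). [folklore] -/
def IsClosed (D : FramedLinkDiagram ι) : Prop :=
  D.word.foldlM (fun r s => s.step r) [] = some []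

/-- Closedness is decidable (finite data). [folklore] -/
instance : Decidable D.IsClosed := by unfold IsClosed; infer_instance

/-! ## 2. The Gauss reading: crossings, passages, signs, successors -/

/-- The levels (indices in the word) of the crossing slices, increasing. [folklore] -/
def crossLevels : List ℕ :=
  (List.range D.word.length).filter fun m => (D.word[m]?.map Slice.isCross).getD false

/-- The number of crossings of the diagram. [folklore] -/
def numCross : ℕ := D.crossLevels.length

/-- The level of crossing number `k` (crossings are numbered from bottom to top). [folklore] -/
def crossLevel (k : Fin D.numCross) : ℕ := D.crossLevels[k.1]'k.2

/-- The position of crossing number `k`: it exchanges the strands `crossPos k, crossPos k + 1`.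
[folklore] -/
def crossPos (k : Fin D.numCross) : ℕ := (D.word[D.crossLevel k]?.map Slice.pos).getD 0

/-- The `over` bit of crossing `k`: the bottom-left-to-top-right strand is over. [folklore] -/
def crossOver (k : Fin D.numCross) : Bool := (D.word[D.crossLevel k]?.map Slice.overBit).getD false

/-- The number of the crossing at level `m`, if slice `m` is a crossing. [folklore] -/
def levelIndex (m : ℕ) : Option (Fin D.numCross) :=
  (List.finRange D.numCross).find? fun k => D.crossLevel k = m

/-- **Passages**: crossing `k` is passed twice, by the strand occupying its bottom-left and
top-right ends (`(k, true)`) and by the strand occupying its bottom-right and top-left ends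
(`(k, false)`), whatever their orientations. These are the `2 · numCross` marked points of the
Gauss diagram. [folklore] -/
abbrev Passage : Type := Fin D.numCross × Bool

/-- The over-passage of crossing `k` is `(k, crossOver k)`, the under-passage `(k, !crossOver k)`.
[folklore] -/
def overPassage (k : Fin D.numCross) : D.Passage := (k, D.crossOver k)

/-- The under-passage of crossing `k`. [folklore] -/
def underPassage (k : Fin D.numCross) : D.Passage := (k, !D.crossOver k)

/-- The port (label, orientation) of a passage, read on the row below its crossing (`none` if the
word is ill formed there). [folklore] -/
def passagePort (x : D.Passage) : Option (Port ι) :=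
  (D.rowBelow (D.crossLevel x.1)).bind fun r =>
    r[if x.2 then D.crossPos x.1 else D.crossPos x.1 + 1]?

/-- The component label of a passage. [folklore] -/
def passageLabel (x : D.Passage) : Option ι := (D.passagePort x).map Prod.fst

/-- The **sign** of crossing `k`: with `t₁ = ±(1, 1)` the velocity of the bottom-left-to-top-right
strand and `t₂ = ±(-1, 1)` that of the other strand (signs from the vertical orientations),
`sign k = sign det (tₒᵥₑᵣ, tᵤₙₔₑᵣ)`, i.e. `(over ? 1 : -1) · (up₁ ? 1 : -1) · (up₂ ? 1 : -1)`;
right-handed crossings are `+1` (Juhász (2023), Def. 4.5; the convention of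
`Knot.RegularProjection.sign_eq`). Junk `1` if the word is ill formed there. [cite: Juhasz2023, Def. 4.5] -/
def crossSign (k : Fin D.numCross) : ℤˣ :=
  match D.passagePort (k, true), D.passagePort (k, false) with
  | some (_, u₁), some (_, u₂) =>
      (if D.crossOver k then 1 else -1) * (if u₁ then 1 else -1) * (if u₂ then 1 else -1)
  | _, _ => 1

/-- States of the strand tracer: moving through the horizontal line number `m` at position `p`
upwards (`up = true`) or downwards; arrived at the crossing at level `m` along its
bottom-left–top-right strand (`bl = true`) or along the other strand; or stuck (ill-formed word).
[folklore] -/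
inductive TraceState
  /-- crossing the horizontal line `m` at position `p`, moving up or down -/
  | go (m p : ℕ) (up : Bool)
  /-- arrived at the crossing slice at level `m`, on its bottom-left (`bl`) or bottom-right strand -/
  | hit (m : ℕ) (bl : Bool)
  /-- the word is ill formed along this strand -/
  | stuck
  deriving DecidableEq, Repr

/-- **One step of the tracer** along the oriented strand: through the next slice above (moving
up) or below (moving down); cups and caps turn the strand round, a crossing slice entered at one
of its two positions is a hit, other slices renumber the position. [folklore] -/
def traceStep : ℕ → ℕ → Bool → TraceState
  | m, p, true =>
      match D.word[m]? with
      | none => .stuck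
      | some (.cup j _ _) => .go (m + 1) (if j ≤ p then p + 2 else p) true
      | some (.cap j) =>
          if p = j then .go m (j + 1) false else if p = j + 1 then .go m j false
          else .go (m + 1) (if j + 1 < p then p - 2 else p) true
      | some (.cross j _) =>
          if p = j then .hit m true else if p = j + 1 then .hit m false else .go (m + 1) p true
  | 0, _, false => .stuck
  | m + 1, p, false =>
      match D.word[m]? with
      | none => .stuck
      | some (.cup j _ _) =>
          if p = j then .go (m + 1) (j + 1) true else if p = j + 1 then .go (m + 1) j true
          else .go m (if j + 1 < p then p - 2 else p) false
      | some (.cap j) => .go m (if j ≤ p then p + 2 else p) false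
      | some (.cross j _) =>
          if p = j then .hit m false else if p = j + 1 then .hit m true else .go m p false

/-- Run the tracer for at most `fuel` steps. [folklore] -/
def traceRun : ℕ → TraceState → TraceState
  | 0, s => s
  | _ + 1, .hit m bl => .hit m bl
  | _ + 1, .stuck => .stuck
  | f + 1, .go m p up =>
      match D.traceStep m p up with
      | .go m' p' up' => traceRun f (.go m' p' up')
      | s => s

/-- Enough fuel to traverse any strand of the picture (the tracer visits each state at most once
and there are at most `2 · (length + 1) · (2 · length + 1)` states). [folklore] -/
def fuel : ℕ := 4 * (D.word.length + 1) ^ 2 + 1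

/-- The state in which the strand of passage `x` LEAVES its crossing: upwards through the line
above the crossing (at the swapped position) if it is oriented upwards, downwards through the line
below it otherwise. [folklore] -/
def exitState (x : D.Passage) : Option TraceState :=
  (D.passagePort x).map fun cu =>
    let m := D.crossLevel x.1
    let i := D.crossPos x.1
    if cu.2 then .go (m + 1) (if x.2 then i + 1 else i) true
    else .go m (if x.2 then i else i + 1) false

/-- **The traversal successor of a passage**: the next passage through a crossing met along the
oriented strand (the `next` of the link Gauss diagram, `LinkGaussDiagram.next`); `none` if the
word is ill formed along the way. [cite: GPV2000, §1] -/
def succ? (x : D.Passage) : Option D.Passage :=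
  match (D.exitState x).map (D.traceRun D.fuel) with
  | some (.hit m bl) => (D.levelIndex m).map fun k => (k, bl)
  | _ => none

/-- The labels of the cups (with multiplicity): the components drawn. [folklore] -/
def cupLabels : List ι :=
  D.word.filterMap fun s => match s with
    | .cup _ c _ => some c
    | _ => none

/-- The labels met at crossings (with multiplicity). [folklore] -/
def crossLabels : List ι :=
  (List.finRange D.numCross).flatMap fun k =>
    ((D.passageLabel (k, true)).toList ++ (D.passageLabel (k, false)).toList)

/-- The **crossing-free components**: labels drawn but met at no crossing (the chord-free circles
`free` of the link Gauss diagram). [folklore] -/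
def freeLabels : Set ι := {c | c ∈ D.cupLabels ∧ c ∉ D.crossLabels}

/-- The **writhe of component `c`**: the sum of the signs of its self-crossings. With the integer
framing `framing c`, the push-off of `c` is its blackboard parallel with `framing c - writhe c`
extra full twists (`twistDefect`). Kauffman (1991), I §9; Gompf–Stipsicz (1999), §4.4.
[cite: Kauffman1991, Part I §9] -/
def writhe (c : ι) : ℤ :=
  ((List.finRange D.numCross).filter fun k =>
      decide (D.passageLabel (k, true) = some c ∧ D.passageLabel (k, false) = some c)).foldr
    (fun k s => (D.crossSign k : ℤ) + s) 0

/-- **Twice the linking number** of the components `c ≠ c'` read off the diagram: the sum of the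
signs of the crossings between them (Rolfsen (1976), §5.D (1)). [cite: Rolfsen1976, §5.D] -/
def lk2 (c c' : ι) : ℤ :=
  ((List.finRange D.numCross).filter fun k =>
      decide ((D.passageLabel (k, true) = some c ∧ D.passageLabel (k, false) = some c') ∨
        (D.passageLabel (k, true) = some c' ∧ D.passageLabel (k, false) = some c))).foldr
    (fun k s => (D.crossSign k : ℤ) + s) 0

/-- The framing correction of component `c`: the number of full twists (with sign) to add to the
blackboard parallel of `c` to obtain the push-off with linking number `framing c`.
Gompf–Stipsicz (1999), §4.4. [cite: GompfStipsicz1999, §4.4] -/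
def twistDefect (c : ι) : ℤ := D.framing c - D.writhe c

/-! ### Closed curves of the picture (each label must be ONE curve) -/

/-- One step of the CURVE tracer: as `traceStep`, but passing straight through crossings, and
reporting the level of a cup when the curve turns round at its bottom. [folklore] -/
def curveStep : ℕ → ℕ → Bool → Option (ℕ × ℕ × Bool) × Option ℕ
  | m, p, true =>
      match D.word[m]? with
      | none => (none, none)
      | some (.cup j _ _) => (some (m + 1, (if j ≤ p then p + 2 else p), true), none)
      | some (.cap j) =>
          if p = j then (some (m, j + 1, false), none)
          else if p = j + 1 then (some (m, j, false), none)
          else (some (m + 1, (if j + 1 < p then p - 2 else p), true), none)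
      | some (.cross j _) =>
          (some (m + 1, (if p = j then j + 1 else if p = j + 1 then j else p), true), none)
  | 0, _, false => (none, none)
  | m + 1, p, false =>
      match D.word[m]? with
      | none => (none, none)
      | some (.cup j _ _) =>
          if p = j then (some (m + 1, j + 1, true), some m)
          else if p = j + 1 then (some (m + 1, j, true), some m)
          else (some (m, (if j + 1 < p then p - 2 else p), false), none)
      | some (.cap j) => (some (m, (if j ≤ p then p + 2 else p), false), none)
      | some (.cross j _) =>
          (some (m, (if p = j then j + 1 else if p = j + 1 then j else p), false), none)

/-- Run the curve tracer from a state for at most `fuel` steps, collecting the cups at which the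
curve turns, and stopping when it turns at the cup of level `m₀` (back at the start). [folklore] -/
def curveRun (m₀ : ℕ) : ℕ → ℕ × ℕ × Bool → List ℕ
  | 0, _ => []
  | f + 1, (m, p, up) =>
      match D.curveStep m p up with
      | (none, _) => []
      | (some s, none) => curveRun m₀ f s
      | (some s, some l) => if l = m₀ then [l] else l :: curveRun m₀ f s

/-- The cups lying on the closed curve through the cup at level `m` (started upwards on its right
branch; junk if slice `m` is not a cup or the word is ill formed). [folklore] -/
def curveCups (m : ℕ) : List ℕ :=
  match D.word[m]? with
  | some (.cup j _ _) => D.curveRun m D.fuel (m + 1, j + 1, true)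
  | _ => []

/-- The label of the cup at level `m`, if slice `m` is a cup. [folklore] -/
def cupLabelAt (m : ℕ) : Option ι :=
  D.word[m]?.bind fun s => match s with
    | .cup _ c _ => some c
    | _ => none

/-- **Each label is one curve**: any two cups with the same label lie on the same closed curve of
the picture. [folklore] -/
def LabelsConnected (D : FramedLinkDiagram ι) : Prop :=
  ∀ m < D.word.length, ∀ m' < D.word.length, ∀ c ∈ D.cupLabelAt m,
    D.cupLabelAt m' = some c → m' ∈ D.curveCups m

/-- `LabelsConnected` is decidable (finite data). [folklore] -/
instance : Decidable D.LabelsConnected := by unfold LabelsConnected; infer_instance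

/-- **Well-formed diagrams**: the word is closed, every label of `ι` is drawn, and each label is
one closed curve — so the picture is an oriented link diagram with components indexed by `ι`.
[folklore] -/
def IsWellFormed (D : FramedLinkDiagram ι) : Prop :=
  D.IsClosed ∧ D.LabelsConnected ∧ ∀ c : ι, c ∈ D.cupLabels

/-- Well-formedness is decidable when the labels form a finite decidable type. [folklore] -/
instance [Fintype ι] : Decidable D.IsWellFormed := by unfold IsWellFormed; infer_instance

end Reading

/-! ## 3. Realisation -/

section Realisation

variable [DecidableEq ι]

/-- **`D.Realises L`: the framed link diagram `D` is a diagram of the framed link `L ⊆ S³`.**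
The framings of `L` are the integers of `D`; the word of `D` is well formed; and some regular
projection `P` of the underlying link (`Link.RegularProjection`: stereographic from the north
pole, with its honest geometric clauses) READS the Gauss datum of `D`: there are a numbering
`κ` of the chords of `P.diagram` by the crossings of `D` and a numbering `e` of its marked points
by the passages of `D` such that chord `κ k` has over-passage `e (k, over k)`, under-passage
`e (k, !over k)` and the sign of crossing `k`; the traversal successor `P.diagram.next`
corresponds to `D.succ?`; the component of each marked point is the label of the passage; and the
chord-free circles of `P` are the crossing-free labels of `D`. (GPV (2000), §1: the Gauss diagram
of a link diagram; Chmutov–Duzhin–Mostovoy (2012), §1.6.5, §1.8.4.) Like `Link.HasGaussDiagram`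
this is a predicate on the embedding, not invariant under isotopy. [cite: GPV2000, §1] -/
def Realises (D : FramedLinkDiagram ι) (L : FramedLink ι) : Prop :=
  D.IsWellFormed ∧ L.framing = D.framing ∧
  ∃ (P : L.toLink.RegularProjection) (κ : Fin D.numCross ≃ Fin P.diagram.n)
    (e : D.Passage ≃ Fin (2 * P.diagram.n)),
    (∀ k, P.diagram.overPos (κ k) = e (D.overPassage k)) ∧
    (∀ k, P.diagram.underPos (κ k) = e (D.underPassage k)) ∧
    (∀ k, P.diagram.sign (κ k) = D.crossSign k) ∧
    (∀ x, ∃ y, D.succ? x = some y ∧ P.diagram.next (e x) = e y) ∧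
    (∀ x, D.passageLabel x = some (P.comp (e x))) ∧
    range P.freeComp = D.freeLabels

variable {D : FramedLinkDiagram ι} {L : FramedLink ι}

/-- A realised diagram is well formed. [folklore] -/
theorem Realises.isWellFormed (h : D.Realises L) : D.IsWellFormed := h.1

/-- A realised diagram carries the framings of the link. [folklore] -/
theorem Realises.framing_eq (h : D.Realises L) : L.framing = D.framing := h.2.1

/-- The underlying link of a realised framed link has a regular projection with as many chords as
the diagram has crossings. [folklore] -/
theorem Realises.exists_regularProjection (h : D.Realises L) :
    ∃ P : L.toLink.RegularProjection, P.diagram.n = D.numCross := by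
  obtain ⟨-, -, P, κ, -⟩ := h
  have hκ := Fintype.card_congr κ
  simp only [Fintype.card_fin] at hκ
  exact ⟨P, hκ.symm⟩

/-- A framed link with a diagram has finitely many components. [folklore] -/
theorem Realises.finite (h : D.Realises L) : Finite ι := by
  obtain ⟨-, -, P, -⟩ := h
  exact P.finite_index

/-- Every component of a realised link is drawn in the diagram. [folklore] -/
theorem Realises.mem_cupLabels (h : D.Realises L) (c : ι) : c ∈ D.cupLabels := h.1.2.2 c

/-- The successor of every passage of a realised diagram is defined. [folklore] -/
theorem Realises.isSome_succ? (h : D.Realises L) (x : D.Passage) : (D.succ? x).isSome := by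
  obtain ⟨-, -, P, κ, e, -, -, -, hs, -⟩ := h
  obtain ⟨y, hy, -⟩ := hs x
  simp [hy]

end Realisation

/-! ## 4. Named facts: existence of diagrams (R1) and of realisations -/

/-- **R1. Generic projections in Morse position exist.** Every framed link with finitely many
components is isotopic (as a framed link: ambient isotopy and equal framings,
`FramedLink.IsIsotopic`) to one realising some framed link diagram: a small isotopy puts the link
in regular position with respect to the stereographic projection (immersed plane curves with
transverse double points only, missing the north pole — Reidemeister (1932), Kap. I §1; the knot
case is `Knot.exists_hasGaussDiagram_of_isIsotopic`), and a further small planar isotopy makes the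
height of the page a Morse function on the diagram with critical points and crossings at
distinct heights, after which the diagram is cut into elementary slices (Chmutov–Duzhin–Mostovoy
(2012), §1.6.5: "A link can be cut into several simple tangles by a finite set of horizontal
planes"; Kauffman (1991), I §9). Named fact (D-0014). [cite: ChmutovDuzhinMostovoy2012, §1.6.5] -/
def _root_.Literature.Topology.FourManifolds.FramedLink.exists_realises_of_isIsotopic : Prop :=
  ∀ {ι : Type u} [DecidableEq ι] [Finite ι] (L : FramedLink ι),
    ∃ (L' : FramedLink ι) (D : FramedLinkDiagram ι), L.IsIsotopic L' ∧ D.Realises L'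

/-- **Every well-formed diagram is the diagram of a framed link** (so that a framed link may be
NAMED by a closed term `D`): draw the sliced picture in a plane of `𝕊 3 ∖ {northPole} ≅ ℝ² × ℝ`,
separate the two strands of each crossing in the `height` direction as prescribed by `over`,
smooth, and attach the integers `D.framing`; the stereographic projection of the resulting link
reads `D` (Juhász (2023), proof of Thm. 4.4, last paragraph; Chmutov–Duzhin–Mostovoy (2012),
§1.6.5: a product of simple tangles IS a tangle). Named fact (D-0014).
[cite: ChmutovDuzhinMostovoy2012, §1.6.5] -/
def exists_realises_of_isWellFormed : Prop :=
  ∀ {ι : Type u} [DecidableEq ι] (D : FramedLinkDiagram ι), D.IsWellFormed →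
    ∃ L : FramedLink ι, D.Realises L

/-! ## 5. Examples and the bridge to plat words -/

section Examples

/-- The standard diagram of the **`0`-framed unlink with `n` numbered components**: `n` round
circles one above the other, the concatenation over `k : Fin n` of `[cup 0 k true, cap 0]`, all
framings `0` (cf. `FramedLink.IsZeroFramedUnlink`). Gompf–Stipsicz (1999), §5.1.
[cite: GompfStipsicz1999, §5.1] -/
def unlinkDiagram (n : ℕ) : FramedLinkDiagram (Fin n) where
  word := (List.finRange n).flatMap fun k => [.cup 0 k true, .cap 0]
  framing := 0

/-- The standard diagram of the **Hopf link** with framings `(a, b)`: component `0` is the outer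
circle, component `1` the inner one, clasped by two crossings of the same type (the positive Hopf
link for the orientations chosen: both crossings are `+1`, `lk = +1`). Rolfsen (1976), §5.D.
[cite: Rolfsen1976, §5.D] -/
def hopfDiagram (a b : ℤ) : FramedLinkDiagram (Fin 2) where
  word := [.cup 0 0 true, .cup 1 1 false, .cross 2 false, .cross 2 false, .cap 1, .cap 0]
  framing := ![a, b]

/-- The standard diagram of the **right-handed trefoil** as a `1`-component framed link with
framing `m`: the two-bridge picture — two minima side by side, three positive half-twists between
the two inner strands, two maxima side by side (writhe `3`; each crossing is passed twice, the
Gauss word is `1 2 3 1 2 3`). Rolfsen (1976), §3.A. [cite: Rolfsen1976, §3.A] -/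
def trefoilDiagram (m : ℤ) : FramedLinkDiagram (Fin 1) where
  word := [.cup 0 0 false, .cup 2 0 true, .cross 1 true, .cross 1 true, .cross 1 true,
    .cap 0, .cap 0]
  framing := fun _ => m

/-- The unlink diagram is well formed (checked by computation for `n = 3`). [folklore] -/
example : (unlinkDiagram 3).IsWellFormed := by decide

/-- The Hopf diagram is well formed, has two crossings, both positive, and linking number `1`
(`lk2 = 2`). [folklore] -/
example : (hopfDiagram 0 0).IsWellFormed ∧ (hopfDiagram 0 0).numCross = 2 ∧
    (hopfDiagram 0 0).lk2 0 1 = 2 := by decide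

/-- The trefoil diagram is well formed and has writhe `3`. [folklore] -/
example : (trefoilDiagram 0).IsWellFormed ∧ (trefoilDiagram 0).writhe 0 = 3 := by decide

end Examples

end FramedLinkDiagram

end Literature.Topology.FourManifolds
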